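import Literature.Analysis.ODE.LiouvilleGreenVolterraBound
import Literature.Analysis.ODE.LiouvilleGreenApproximant
import HarnessLib

/-!
# Olver's Liouville–Green approximation theorem with error bounds: the exponential case `f > 0`

Topic `Literature/Analysis/ODE` (namespace `Literature.Analysis.ODE`). Everything is proved; no
definitions.

F. W. J. Olver, *Asymptotics and Special Functions* (1974), Ch. 6 Thm 2.1, with the large
parameter `u` of Ch. 10 Thm 3.1 (= DLMF §2.7(iii)): on a compact interval `[α, β]` let `u > 0`,
`f ∈ C²` positive, `g ∈ C⁰`, and let `F = ∫(f^{-1/4}(f^{-1/4})″ − g f^{-1/2}) dx` be the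
ERROR-CONTROL FUNCTION, `F′ = Φ := 5f′²/(16f^{5/2}) − f″/(4f^{3/2}) − g/f^{1/2}`. Then
`w″ = (u² f + g) w` has solutions

  `w₁ = f^{-1/4} e^{+uξ}(1 + ε₁)`, `w₂ = f^{-1/4} e^{−uξ}(1 + ε₂)`,  `ξ = ∫_α^x √f`,

with `ε₁(α) = 0 = ε₂(β)` and

  `|ε₁(x)| ≤ exp(u⁻¹ ∫_α^x |Φ|) − 1`, `|ε₂(x)| ≤ exp(u⁻¹ ∫_x^β |Φ|) − 1`,
  `|ε_j′(x)| ≤ u √f(x) · (same bracket)`.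

Olver's constants are sharper by a factor `½` in the exponent (`exp(𝒱/(2u)) − 1`), obtained from
the oscillation-free kernel `0 ≤ 1 − e^{2u(v−ξ)} < 1` of his Volterra equation (2.09); the bounds
here come from the kernel-free a priori estimate `norm_lgError_le`
(`LiouvilleGreenVolterraBound.lean`) and suffice for all uses where only `𝒱(F)/u → 0` matters.

* `exists_lgSolution_left` / `exists_lgSolution_right` — the two solutions for an ARBITRARY
  primitive `ξ` of `√f` within `[α, β]` and one-sided `C²` data (`HasDerivWithinAt` on `Icc`);
* `exists_lgSolutions_of_pos` — the packaged statement with `ξ = ∫_α^x √f`, `C¹` on `[α, β]`,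
  classical derivatives in the interior, and the derivative constant weakened to `2u√f` (the
  form consumed by the uniform reduction of the separated Kerr wave equation, where `f, g` come
  from the blown-up radial Teukolsky potential).

Proof: `w` is THE solution with the Cauchy data of `f^{-1/4}e^{±uξ}` at the end-point
(`exists_solution_Icc`); the LG pair solves `E″ = (u²f + g + √fΦ)E` exactly with Wronskian `2u`
and `|E₊||E₋| = f^{-1/2}` (`LiouvilleGreenApproximant.lean`), and `ξ` is monotone, so
`norm_lgError_le` applies with `m = |Φ|`, `c = 2u`.

## References

* F. W. J. Olver, *Asymptotics and Special Functions*, Academic Press 1974, Ch. 6 Thm 2.1,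
  Ch. 10 Thm 3.1. Key `Olver1974`.
* NIST DLMF §2.7(iii). Key `DLMF`.
-/

noncomputable section

namespace Literature.Analysis.ODE

open Set Filter intervalIntegral
open _root_.MeasureTheory
open scoped _root_.Topology

variable {u α β : ℝ} {f f' f'' g ξ : ℝ → ℝ}

/-- **Olver's LG theorem, exponential case, solution normalised at the left end-point.**
Let `u > 0`, `α ≤ β`, `f ∈ C²[α, β]` (one-sided derivatives `f'`, `f''` within `[α, β]`), `f > 0`,
`g ∈ C[α, β]`, and let `ξ` be ANY primitive of `√f` within `[α, β]`. Then `w'' = (u² f + g) w` has a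
solution `w = f^{-1/4} e^{uξ} (1 + ε)` on `[α, β]` with `ε(α) = 0`,
`|ε(x)| ≤ exp(u⁻¹ 𝒱_{α,x}(F)) − 1` and `|ε'(x)| ≤ u √f(x) (exp(u⁻¹ 𝒱_{α,x}(F)) − 1)`, where
`𝒱_{α,x}(F) = ∫_α^x |Φ|`, `Φ = 5f'²/(16f^{5/2}) − f''/(4f^{3/2}) − g/f^{1/2}` is the derivative of
the error-control function `F = ∫ (f^{-1/4}(f^{-1/4})'' − g f^{-1/2})`. This is Olver's Theorem 2.1 of
Ch. 6 with the large parameter of Ch. 10 §3 (replace `f` by `u²f`: `F ↦ F/u`), stated with the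
constant `u⁻¹` in the exponent in place of Olver's sharper `(2u)⁻¹`; proof by the a priori bound
`norm_lgError_le` (variation of parameters against the LG pair + Grönwall) for the solution with
the Cauchy data of `f^{-1/4}e^{uξ}` at `α`. [cite: Olver1974, Ch. 6 Thm 2.1 & Ch. 10 Thm 3.1] -/
theorem exists_lgSolution_left (hu : 0 < u) (hαβ : α ≤ β)
    (hf : ∀ t ∈ Icc α β, HasDerivWithinAt f (f' t) (Icc α β) t ∧
      HasDerivWithinAt f' (f'' t) (Icc α β) t)
    (hf'' : ContinuousOn f'' (Icc α β)) (hg : ContinuousOn g (Icc α β))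
    (hpos : ∀ t ∈ Icc α β, 0 < f t)
    (hξ : ∀ t ∈ Icc α β, HasDerivWithinAt ξ (Real.sqrt (f t)) (Icc α β) t) :
    ∃ w w' ε ε' : ℝ → ℝ, ε α = 0 ∧ ∀ x ∈ Icc α β,
      w x = f x ^ (-(1 / 4 : ℝ)) * Real.exp (u * ξ x) * (1 + ε x) ∧
      |ε x| ≤ Real.exp (u⁻¹ * ∫ t in α..x, |5 * f' t ^ 2 / (16 * f t ^ (5 / 2 : ℝ)) -
        f'' t / (4 * f t ^ (3 / 2 : ℝ)) - g t / Real.sqrt (f t)|) - 1 ∧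
      |ε' x| ≤ u * Real.sqrt (f x) * (Real.exp (u⁻¹ * ∫ t in α..x, |5 * f' t ^ 2 /
        (16 * f t ^ (5 / 2 : ℝ)) - f'' t / (4 * f t ^ (3 / 2 : ℝ)) - g t / Real.sqrt (f t)|) - 1) ∧
      HasDerivWithinAt w (w' x) (Icc α β) x ∧
      HasDerivWithinAt w' ((u ^ 2 * f x + g x) * w x) (Icc α β) x ∧
      HasDerivWithinAt ε (ε' x) (Icc α β) x := by
  have hα : α ∈ Icc α β := left_mem_Icc.2 hαβ
  set S := Icc α β with hS
  set E₁ : ℝ → ℝ := fun t ↦ f t ^ (-(1 / 4 : ℝ)) * Real.exp (u * ξ t) with hE₁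
  set dE₁ : ℝ → ℝ := fun t ↦ f t ^ (-(1 / 4 : ℝ)) * Real.exp (u * ξ t) *
    (-f' t / (4 * f t) + u * Real.sqrt (f t)) with hdE₁
  set E₂ : ℝ → ℝ := fun t ↦ f t ^ (-(1 / 4 : ℝ)) * Real.exp (-u * ξ t) with hE₂
  set dE₂ : ℝ → ℝ := fun t ↦ f t ^ (-(1 / 4 : ℝ)) * Real.exp (-u * ξ t) *
    (-f' t / (4 * f t) + -u * Real.sqrt (f t)) with hdE₂
  set q : ℝ → ℝ := fun t ↦ u ^ 2 * f t + g t with hq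
  set ρ : ℝ → ℝ := fun t ↦ 5 * f' t ^ 2 / (16 * f t ^ 2) - f'' t / (4 * f t) - g t with hρ
  set Φ : ℝ → ℝ := fun t ↦ 5 * f' t ^ 2 / (16 * f t ^ (5 / 2 : ℝ)) -
    f'' t / (4 * f t ^ (3 / 2 : ℝ)) - g t / Real.sqrt (f t) with hΦ
  -- continuity of the coefficients
  have hfc : ContinuousOn f S := fun t ht ↦ (hf t ht).1.continuousWithinAt
  have hf'c : ContinuousOn f' S := fun t ht ↦ (hf t ht).2.continuousWithinAt
  have hqc : ContinuousOn q S := (continuousOn_const.mul hfc).add hg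
  have hΦc : ContinuousOn Φ S := continuousOn_lgErrorControl hfc hf'c hf'' hg hpos
  -- the solution with the Cauchy data of `E₁` at `α`
  obtain ⟨w, dw, hw0, hw1, hw⟩ := exists_solution_Icc hqc hα (E₁ α) (dE₁ α)
  -- the LG pair solves the comparison equation `E'' = (q + ρ) E`
  have hE₁d : ∀ t ∈ S, HasDerivWithinAt E₁ (dE₁ t) S t ∧
      HasDerivWithinAt dE₁ ((q t + ρ t) * E₁ t) S t := fun t ht ↦ by
    obtain ⟨h1, h2⟩ := hasDerivWithinAt_lgExp u (hf t ht).1 (hf t ht).2 (hξ t ht) (hpos t ht)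
    exact ⟨h1, h2.congr_deriv (by simp only [hq, hρ, hE₁]; ring)⟩
  have hE₂d : ∀ t ∈ S, HasDerivWithinAt E₂ (dE₂ t) S t ∧
      HasDerivWithinAt dE₂ ((q t + ρ t) * E₂ t) S t := fun t ht ↦ by
    obtain ⟨h1, h2⟩ := hasDerivWithinAt_lgExp (-u) (hf t ht).1 (hf t ht).2 (hξ t ht) (hpos t ht)
    exact ⟨h1, h2.congr_deriv (by simp only [hq, hρ, hE₂]; ring)⟩
  have hW : ∀ t ∈ S, E₂ t * dE₁ t - dE₂ t * E₁ t = 2 * u := fun t ht ↦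
    lgExp_wronskian u (hpos t ht)
  have hE₁0 : ∀ t ∈ S, E₁ t ≠ 0 := fun t ht ↦ (lgExp_pos u (hpos t ht)).ne'
  have hE₂0 : ∀ t ∈ S, E₂ t ≠ 0 := fun t ht ↦ (lgExp_pos (-u) (hpos t ht)).ne'
  -- `ξ` is non-decreasing, so `|E₁|/|E₂| = e^{2uξ}` is non-decreasing
  have hξmono : MonotoneOn ξ S := by
    refine monotoneOn_of_deriv_nonneg (convex_Icc α β)
      (fun t ht ↦ (hξ t ht).continuousWithinAt) (fun t ht ↦ ?_) (fun t ht ↦ ?_)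
    · rw [interior_Icc] at ht
      exact ((hξ t (Ioo_subset_Icc_self ht)).hasDerivAt
        (Icc_mem_nhds ht.1 ht.2)).differentiableAt.differentiableWithinAt
    · rw [interior_Icc] at ht
      rw [((hξ t (Ioo_subset_Icc_self ht)).hasDerivAt (Icc_mem_nhds ht.1 ht.2)).deriv]
      exact Real.sqrt_nonneg _
  have hmono : ∀ ⦃t⦄, t ∈ S → ∀ ⦃x⦄, x ∈ S → t ≤ x → ‖E₂ x‖ * ‖E₁ t‖ ≤ ‖E₁ x‖ * ‖E₂ t‖ := by
    intro t ht x hx htx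
    have h := hξmono ht hx htx
    simp only [hE₁, hE₂, Real.norm_eq_abs]
    rw [abs_of_pos (lgExp_pos _ (hpos x hx)), abs_of_pos (lgExp_pos _ (hpos t ht)),
      abs_of_pos (lgExp_pos _ (hpos x hx)), abs_of_pos (lgExp_pos _ (hpos t ht))]
    have hAx := (Real.rpow_pos_of_pos (hpos x hx) (-(1 / 4 : ℝ))).le
    have hAt := (Real.rpow_pos_of_pos (hpos t ht) (-(1 / 4 : ℝ))).le
    have key : Real.exp (-u * ξ x) * Real.exp (u * ξ t) ≤
        Real.exp (u * ξ x) * Real.exp (-u * ξ t) := by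
      rw [← Real.exp_add, ← Real.exp_add, Real.exp_le_exp]
      nlinarith
    calc f x ^ (-(1 / 4 : ℝ)) * Real.exp (-u * ξ x) * (f t ^ (-(1 / 4 : ℝ)) * Real.exp (u * ξ t))
        = f x ^ (-(1 / 4 : ℝ)) * f t ^ (-(1 / 4 : ℝ)) *
            (Real.exp (-u * ξ x) * Real.exp (u * ξ t)) := by ring
      _ ≤ f x ^ (-(1 / 4 : ℝ)) * f t ^ (-(1 / 4 : ℝ)) *
            (Real.exp (u * ξ x) * Real.exp (-u * ξ t)) := by gcongr
      _ = _ := by ring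
  -- the majorant `m = |Φ|` and `|ρ| |E₁| |E₂| = |Φ|`
  have hm : ContinuousOn (fun t ↦ |Φ t|) S := continuous_abs.comp_continuousOn hΦc
  have hρE : ∀ t ∈ S, ‖ρ t‖ * (‖E₁ t‖ * ‖E₂ t‖) ≤ |Φ t| := by
    intro t ht
    rw [Real.norm_eq_abs, Real.norm_eq_abs, Real.norm_eq_abs,
      abs_lgExp_mul_abs_lgExp_neg u (hpos t ht)]
    simp only [hΦ, hρ]
    rw [lgErrorControl_eq_div_sqrt (hpos t ht), abs_div,
      abs_of_pos (Real.sqrt_pos.2 (hpos t ht))]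
    exact le_of_eq (div_eq_mul_inv _ _).symm
  -- the a priori bound
  have key := norm_lgError_le hw hE₁d hE₂d hW (by positivity) hE₁0 hE₂0 hmono hm hρE hw0 hw1
  have hc : (2 : ℝ) / ‖(2 * u : ℝ)‖ = u⁻¹ := by
    rw [Real.norm_eq_abs, abs_of_pos (by positivity)]
    field_simp
  refine ⟨w, dw, fun x ↦ w x / E₁ x - 1, fun x ↦ (E₁ x * dw x - dE₁ x * w x) / E₁ x ^ 2,
    by simp [hw0, div_self (hE₁0 α hα)], fun x hx ↦ ?_⟩
  obtain ⟨k1, k2⟩ := key x hx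
  rw [hc] at k1 k2
  refine ⟨?_, ?_, ?_, (hw x hx).1, (hw x hx).2, ?_⟩
  · have h1 := hE₁0 x hx
    show w x = E₁ x * (1 + (w x / E₁ x - 1))
    field_simp
    ring
  · simpa only [Real.norm_eq_abs] using k1
  · refine (le_of_eq (Real.norm_eq_abs _).symm).trans (k2.trans_eq ?_)
    rw [Real.norm_eq_abs, Real.norm_eq_abs, Real.norm_eq_abs,
      abs_of_pos (by positivity : (0:ℝ) < 2 * u), abs_lgExp_mul_abs_lgExp_neg u (hpos x hx)]
    have hs : Real.sqrt (f x) ≠ 0 := (Real.sqrt_pos.2 (hpos x hx)).ne'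
    congr 1
    field_simp
  · exact (((hw x hx).1.div (hE₁d x hx).1 (hE₁0 x hx)).sub_const 1).congr_deriv (by ring)

/-- **Olver's LG theorem, exponential case, solution normalised at the right end-point.**
Under the hypotheses of `exists_lgSolution_left`, `w'' = (u² f + g) w` also has a solution
`w = f^{-1/4} e^{−uξ} (1 + ε)` on `[α, β]` with `ε(β) = 0`, `|ε(x)| ≤ exp(u⁻¹ 𝒱_{x,β}(F)) − 1` and
`|ε'(x)| ≤ u √f(x) (exp(u⁻¹ 𝒱_{x,β}(F)) − 1)` (the solution with the Cauchy data of
`f^{-1/4}e^{−uξ}` at `β`; a priori bound `norm_lgError_le_of_right`).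
[cite: Olver1974, Ch. 6 Thm 2.1 & Ch. 10 Thm 3.1] -/
theorem exists_lgSolution_right (hu : 0 < u) (hαβ : α ≤ β)
    (hf : ∀ t ∈ Icc α β, HasDerivWithinAt f (f' t) (Icc α β) t ∧
      HasDerivWithinAt f' (f'' t) (Icc α β) t)
    (hf'' : ContinuousOn f'' (Icc α β)) (hg : ContinuousOn g (Icc α β))
    (hpos : ∀ t ∈ Icc α β, 0 < f t)
    (hξ : ∀ t ∈ Icc α β, HasDerivWithinAt ξ (Real.sqrt (f t)) (Icc α β) t) :
    ∃ w w' ε ε' : ℝ → ℝ, ε β = 0 ∧ ∀ x ∈ Icc α β,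
      w x = f x ^ (-(1 / 4 : ℝ)) * Real.exp (-u * ξ x) * (1 + ε x) ∧
      |ε x| ≤ Real.exp (u⁻¹ * ∫ t in x..β, |5 * f' t ^ 2 / (16 * f t ^ (5 / 2 : ℝ)) -
        f'' t / (4 * f t ^ (3 / 2 : ℝ)) - g t / Real.sqrt (f t)|) - 1 ∧
      |ε' x| ≤ u * Real.sqrt (f x) * (Real.exp (u⁻¹ * ∫ t in x..β, |5 * f' t ^ 2 /
        (16 * f t ^ (5 / 2 : ℝ)) - f'' t / (4 * f t ^ (3 / 2 : ℝ)) - g t / Real.sqrt (f t)|) - 1) ∧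
      HasDerivWithinAt w (w' x) (Icc α β) x ∧
      HasDerivWithinAt w' ((u ^ 2 * f x + g x) * w x) (Icc α β) x ∧
      HasDerivWithinAt ε (ε' x) (Icc α β) x := by
  have hβ : β ∈ Icc α β := right_mem_Icc.2 hαβ
  set S := Icc α β with hS
  set E₁ : ℝ → ℝ := fun t ↦ f t ^ (-(1 / 4 : ℝ)) * Real.exp (-u * ξ t) with hE₁
  set dE₁ : ℝ → ℝ := fun t ↦ f t ^ (-(1 / 4 : ℝ)) * Real.exp (-u * ξ t) *
    (-f' t / (4 * f t) + -u * Real.sqrt (f t)) with hdE₁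
  set E₂ : ℝ → ℝ := fun t ↦ f t ^ (-(1 / 4 : ℝ)) * Real.exp (u * ξ t) with hE₂
  set dE₂ : ℝ → ℝ := fun t ↦ f t ^ (-(1 / 4 : ℝ)) * Real.exp (u * ξ t) *
    (-f' t / (4 * f t) + u * Real.sqrt (f t)) with hdE₂
  set q : ℝ → ℝ := fun t ↦ u ^ 2 * f t + g t with hq
  set ρ : ℝ → ℝ := fun t ↦ 5 * f' t ^ 2 / (16 * f t ^ 2) - f'' t / (4 * f t) - g t with hρ
  set Φ : ℝ → ℝ := fun t ↦ 5 * f' t ^ 2 / (16 * f t ^ (5 / 2 : ℝ)) -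
    f'' t / (4 * f t ^ (3 / 2 : ℝ)) - g t / Real.sqrt (f t) with hΦ
  -- continuity of the coefficients
  have hfc : ContinuousOn f S := fun t ht ↦ (hf t ht).1.continuousWithinAt
  have hf'c : ContinuousOn f' S := fun t ht ↦ (hf t ht).2.continuousWithinAt
  have hqc : ContinuousOn q S := (continuousOn_const.mul hfc).add hg
  have hΦc : ContinuousOn Φ S := continuousOn_lgErrorControl hfc hf'c hf'' hg hpos
  -- the solution with the Cauchy data of `E₁` at `β`
  obtain ⟨w, dw, hw0, hw1, hw⟩ := exists_solution_Icc hqc hβ (E₁ β) (dE₁ β)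
  -- the LG pair solves the comparison equation `E'' = (q + ρ) E`
  have hE₁d : ∀ t ∈ S, HasDerivWithinAt E₁ (dE₁ t) S t ∧
      HasDerivWithinAt dE₁ ((q t + ρ t) * E₁ t) S t := fun t ht ↦ by
    obtain ⟨h1, h2⟩ := hasDerivWithinAt_lgExp (-u) (hf t ht).1 (hf t ht).2 (hξ t ht) (hpos t ht)
    exact ⟨h1, h2.congr_deriv (by simp only [hq, hρ, hE₁]; ring)⟩
  have hE₂d : ∀ t ∈ S, HasDerivWithinAt E₂ (dE₂ t) S t ∧
      HasDerivWithinAt dE₂ ((q t + ρ t) * E₂ t) S t := fun t ht ↦ by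
    obtain ⟨h1, h2⟩ := hasDerivWithinAt_lgExp u (hf t ht).1 (hf t ht).2 (hξ t ht) (hpos t ht)
    exact ⟨h1, h2.congr_deriv (by simp only [hq, hρ, hE₂]; ring)⟩
  have hW : ∀ t ∈ S, E₂ t * dE₁ t - dE₂ t * E₁ t = -(2 * u) := fun t ht ↦ by
    have h := lgExp_wronskian (f := f) (f' := f') (ξ := ξ) (t := t) u (hpos t ht)
    linear_combination -h
  have hE₁0 : ∀ t ∈ S, E₁ t ≠ 0 := fun t ht ↦ (lgExp_pos (-u) (hpos t ht)).ne'
  have hE₂0 : ∀ t ∈ S, E₂ t ≠ 0 := fun t ht ↦ (lgExp_pos u (hpos t ht)).ne'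
  -- `ξ` is non-decreasing, so `|E₁|/|E₂| = e^{-2uξ}` is non-increasing
  have hξmono : MonotoneOn ξ S := by
    refine monotoneOn_of_deriv_nonneg (convex_Icc α β)
      (fun t ht ↦ (hξ t ht).continuousWithinAt) (fun t ht ↦ ?_) (fun t ht ↦ ?_)
    · rw [interior_Icc] at ht
      exact ((hξ t (Ioo_subset_Icc_self ht)).hasDerivAt
        (Icc_mem_nhds ht.1 ht.2)).differentiableAt.differentiableWithinAt
    · rw [interior_Icc] at ht
      rw [((hξ t (Ioo_subset_Icc_self ht)).hasDerivAt (Icc_mem_nhds ht.1 ht.2)).deriv]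
      exact Real.sqrt_nonneg _
  have hmono : ∀ ⦃t⦄, t ∈ S → ∀ ⦃x⦄, x ∈ S → x ≤ t → ‖E₂ x‖ * ‖E₁ t‖ ≤ ‖E₁ x‖ * ‖E₂ t‖ := by
    intro t ht x hx hxt
    have h := hξmono hx ht hxt
    simp only [hE₁, hE₂, Real.norm_eq_abs]
    rw [abs_of_pos (lgExp_pos _ (hpos x hx)), abs_of_pos (lgExp_pos _ (hpos t ht)),
      abs_of_pos (lgExp_pos _ (hpos x hx)), abs_of_pos (lgExp_pos _ (hpos t ht))]
    have hAx := (Real.rpow_pos_of_pos (hpos x hx) (-(1 / 4 : ℝ))).le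
    have hAt := (Real.rpow_pos_of_pos (hpos t ht) (-(1 / 4 : ℝ))).le
    have key : Real.exp (u * ξ x) * Real.exp (-u * ξ t) ≤
        Real.exp (-u * ξ x) * Real.exp (u * ξ t) := by
      rw [← Real.exp_add, ← Real.exp_add, Real.exp_le_exp]
      nlinarith
    calc f x ^ (-(1 / 4 : ℝ)) * Real.exp (u * ξ x) * (f t ^ (-(1 / 4 : ℝ)) * Real.exp (-u * ξ t))
        = f x ^ (-(1 / 4 : ℝ)) * f t ^ (-(1 / 4 : ℝ)) *
            (Real.exp (u * ξ x) * Real.exp (-u * ξ t)) := by ring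
      _ ≤ f x ^ (-(1 / 4 : ℝ)) * f t ^ (-(1 / 4 : ℝ)) *
            (Real.exp (-u * ξ x) * Real.exp (u * ξ t)) := by gcongr
      _ = _ := by ring
  -- the majorant `m = |Φ|` and `|ρ| |E₁| |E₂| = |Φ|`
  have hm : ContinuousOn (fun t ↦ |Φ t|) S := continuous_abs.comp_continuousOn hΦc
  have hρE : ∀ t ∈ S, ‖ρ t‖ * (‖E₁ t‖ * ‖E₂ t‖) ≤ |Φ t| := by
    intro t ht
    rw [Real.norm_eq_abs, Real.norm_eq_abs, Real.norm_eq_abs, mul_comm |E₁ t|,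
      abs_lgExp_mul_abs_lgExp_neg u (hpos t ht)]
    simp only [hΦ, hρ]
    rw [lgErrorControl_eq_div_sqrt (hpos t ht), abs_div,
      abs_of_pos (Real.sqrt_pos.2 (hpos t ht))]
    exact le_of_eq (div_eq_mul_inv _ _).symm
  -- the a priori bound
  have key := norm_lgError_le_of_right hw hE₁d hE₂d hW (by simp [hu.ne']) hE₁0 hE₂0 hmono hm
    hρE hw0 hw1
  have hc : (2 : ℝ) / ‖(-(2 * u) : ℝ)‖ = u⁻¹ := by
    rw [norm_neg, Real.norm_eq_abs, abs_of_pos (by positivity)]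
    field_simp
  refine ⟨w, dw, fun x ↦ w x / E₁ x - 1, fun x ↦ (E₁ x * dw x - dE₁ x * w x) / E₁ x ^ 2,
    by simp [hw0, div_self (hE₁0 β hβ)], fun x hx ↦ ?_⟩
  obtain ⟨k1, k2⟩ := key x hx
  rw [hc] at k1 k2
  refine ⟨?_, ?_, ?_, (hw x hx).1, (hw x hx).2, ?_⟩
  · have h1 := hE₁0 x hx
    show w x = E₁ x * (1 + (w x / E₁ x - 1))
    field_simp
    ring
  · simpa only [Real.norm_eq_abs] using k1
  · refine (le_of_eq (Real.norm_eq_abs _).symm).trans (k2.trans_eq ?_)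
    rw [norm_neg, Real.norm_eq_abs, Real.norm_eq_abs, Real.norm_eq_abs,
      abs_of_pos (by positivity : (0:ℝ) < 2 * u), mul_comm |E₁ x|,
      abs_lgExp_mul_abs_lgExp_neg u (hpos x hx)]
    have hs : Real.sqrt (f x) ≠ 0 := (Real.sqrt_pos.2 (hpos x hx)).ne'
    congr 1
    field_simp
  · exact (((hw x hx).1.div (hE₁d x hx).1 (hE₁0 x hx)).sub_const 1).congr_deriv (by ring)

/-- **Olver's Liouville–Green theorem with error bounds, exponential case `f > 0`, in the form
consumed by the separated Kerr wave equation** (Olver 1974, Ch. 6 Thm 2.1 with the large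
parameter `u` of Ch. 10 Thm 3.1 = DLMF §2.7(iii); constants weakened to `exp(𝒱/u) − 1` and
`2u√f`). For `u > 0`, `f ∈ C²[α, β]` positive, `g ∈ C[α, β]`, the equation `w'' = (u² f + g) w`
has two solutions `w₁ = f^{-1/4} e^{+u∫_α^x √f}(1 + ε₁)`, `w₂ = f^{-1/4} e^{−u∫_α^x √f}(1 + ε₂)`,
`C¹` on `[α, β]` and `C²` inside, with `ε₁(α) = 0 = ε₂(β)`,
`|ε₁(x)| ≤ exp(u⁻¹∫_α^x |Φ|) − 1`, `|ε₂(x)| ≤ exp(u⁻¹∫_x^β |Φ|) − 1`,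
`|ε_j'(x)| ≤ 2u√f(x)·(same)`, `Φ = 5f'²/(16f^{5/2}) − f''/(4f^{3/2}) − g/f^{1/2}`.
[cite: Olver1974, Ch. 6 Thm 2.1 & Ch. 10 Thm 3.1] -/
theorem exists_lgSolutions_of_pos (u α β : ℝ) (f f' f'' g : ℝ → ℝ) (hu : 0 < u) (hαβ : α ≤ β)
    (hf : ∀ t ∈ Icc α β, HasDerivAt f (f' t) t ∧ HasDerivAt f' (f'' t) t)
    (hf'' : ContinuousOn f'' (Icc α β)) (hg : ContinuousOn g (Icc α β))
    (hpos : ∀ t ∈ Icc α β, 0 < f t) :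
    ∃ (w₁ w₁' w₂ w₂' ε₁ ε₁' ε₂ ε₂' : ℝ → ℝ),
      (∀ x ∈ Icc α β,
          w₁ x = (f x) ^ (-(1 / 4 : ℝ)) * Real.exp (u * ∫ t in α..x, Real.sqrt (f t)) * (1 + ε₁ x) ∧
          w₂ x = (f x) ^ (-(1 / 4 : ℝ)) * Real.exp (-(u * ∫ t in α..x, Real.sqrt (f t))) *
            (1 + ε₂ x) ∧
          |ε₁ x| ≤ Real.exp (u⁻¹ * ∫ t in α..x, |5 * f' t ^ 2 / (16 * (f t) ^ (5 / 2 : ℝ)) -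
            f'' t / (4 * (f t) ^ (3 / 2 : ℝ)) - g t / Real.sqrt (f t)|) - 1 ∧
          |ε₂ x| ≤ Real.exp (u⁻¹ * ∫ t in x..β, |5 * f' t ^ 2 / (16 * (f t) ^ (5 / 2 : ℝ)) -
            f'' t / (4 * (f t) ^ (3 / 2 : ℝ)) - g t / Real.sqrt (f t)|) - 1 ∧
          |ε₁' x| ≤ 2 * u * Real.sqrt (f x) * (Real.exp (u⁻¹ * ∫ t in α..x, |5 * f' t ^ 2 /
            (16 * (f t) ^ (5 / 2 : ℝ)) - f'' t / (4 * (f t) ^ (3 / 2 : ℝ)) -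
              g t / Real.sqrt (f t)|) - 1) ∧
          |ε₂' x| ≤ 2 * u * Real.sqrt (f x) * (Real.exp (u⁻¹ * ∫ t in x..β, |5 * f' t ^ 2 /
            (16 * (f t) ^ (5 / 2 : ℝ)) - f'' t / (4 * (f t) ^ (3 / 2 : ℝ)) -
              g t / Real.sqrt (f t)|) - 1)) ∧
      ε₁ α = 0 ∧ ε₂ β = 0 ∧
      ContinuousOn w₁ (Icc α β) ∧ ContinuousOn w₁' (Icc α β) ∧
      ContinuousOn w₂ (Icc α β) ∧ ContinuousOn w₂' (Icc α β) ∧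
      (∀ x ∈ Ioo α β,
          HasDerivAt ε₁ (ε₁' x) x ∧ HasDerivAt ε₂ (ε₂' x) x ∧
          HasDerivAt w₁ (w₁' x) x ∧ HasDerivAt w₁' ((u ^ 2 * f x + g x) * w₁ x) x ∧
          HasDerivAt w₂ (w₂' x) x ∧ HasDerivAt w₂' ((u ^ 2 * f x + g x) * w₂ x) x) := by
  have hfw : ∀ t ∈ Icc α β, HasDerivWithinAt f (f' t) (Icc α β) t ∧
      HasDerivWithinAt f' (f'' t) (Icc α β) t := fun t ht ↦
    ⟨(hf t ht).1.hasDerivWithinAt, (hf t ht).2.hasDerivWithinAt⟩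
  have hfc : ContinuousOn f (Icc α β) := fun t ht ↦ (hf t ht).1.continuousAt.continuousWithinAt
  have hξd : ∀ t ∈ Icc α β, HasDerivWithinAt (fun x ↦ ∫ s in α..x, Real.sqrt (f s))
      (Real.sqrt (f t)) (Icc α β) t := fun t ht ↦ hasDerivWithinAt_integral_Icc hfc.sqrt ht
  obtain ⟨w₁, w₁', ε₁, ε₁', h1α, h1⟩ := exists_lgSolution_left hu hαβ hfw hf'' hg hpos hξd
  obtain ⟨w₂, w₂', ε₂, ε₂', h2β, h2⟩ := exists_lgSolution_right hu hαβ hfw hf'' hg hpos hξd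
  -- the brackets `exp(u⁻¹∫|Φ|) − 1` are `≥ 0`
  have hR : ∀ {a b : ℝ}, a ≤ b → Icc a b ⊆ Icc α β → 0 ≤ Real.exp (u⁻¹ * ∫ t in a..b,
      |5 * f' t ^ 2 / (16 * (f t) ^ (5 / 2 : ℝ)) - f'' t / (4 * (f t) ^ (3 / 2 : ℝ)) -
        g t / Real.sqrt (f t)|) - 1 := by
    intro a b hab _
    have : 0 ≤ ∫ t in a..b, |5 * f' t ^ 2 / (16 * (f t) ^ (5 / 2 : ℝ)) -
        f'' t / (4 * (f t) ^ (3 / 2 : ℝ)) - g t / Real.sqrt (f t)| :=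
      intervalIntegral.integral_nonneg hab fun t _ ↦ abs_nonneg _
    have : (1 : ℝ) ≤ Real.exp (u⁻¹ * ∫ t in a..b, |5 * f' t ^ 2 / (16 * (f t) ^ (5 / 2 : ℝ)) -
        f'' t / (4 * (f t) ^ (3 / 2 : ℝ)) - g t / Real.sqrt (f t)|) :=
      Real.one_le_exp_iff.2 (by positivity)
    linarith
  refine ⟨w₁, w₁', w₂, w₂', ε₁, ε₁', ε₂, ε₂', fun x hx ↦ ?_, h1α, h2β,
    fun x hx ↦ (h1 x hx).2.2.2.1.continuousWithinAt,
    fun x hx ↦ (h1 x hx).2.2.2.2.1.continuousWithinAt,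
    fun x hx ↦ (h2 x hx).2.2.2.1.continuousWithinAt,
    fun x hx ↦ (h2 x hx).2.2.2.2.1.continuousWithinAt, fun x hx ↦ ?_⟩
  · obtain ⟨e1, b1, d1, -, -, -⟩ := h1 x hx
    obtain ⟨e2, b2, d2, -, -, -⟩ := h2 x hx
    have hs : 0 ≤ u * Real.sqrt (f x) := by positivity
    refine ⟨e1, by rw [e2, neg_mul], b1, b2, d1.trans ?_, d2.trans ?_⟩
    · have h0 := hR hx.1 (Icc_subset_Icc_right hx.2)
      nlinarith
    · have h0 := hR hx.2 (Icc_subset_Icc_left hx.1)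
      nlinarith
  · have hS : Icc α β ∈ 𝓝 x := Icc_mem_nhds hx.1 hx.2
    obtain ⟨-, -, -, d1, d2, d3⟩ := h1 x (Ioo_subset_Icc_self hx)
    obtain ⟨-, -, -, e1, e2, e3⟩ := h2 x (Ioo_subset_Icc_self hx)
    exact ⟨d3.hasDerivAt hS, e3.hasDerivAt hS, d1.hasDerivAt hS, d2.hasDerivAt hS,
      e1.hasDerivAt hS, e2.hasDerivAt hS⟩

end Literature.Analysis.ODE
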